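import Literature.Analysis.UnboundedOperators.LinearizedBoltzmannGaussWeightAction
import Literature.Analysis.UnboundedOperators.LinearizedBoltzmannChapmanEnskogInverse
import HarnessLib

/-!
# Weighted absorption for Grad's integral equation of the linearised hard-sphere operator (`ℝ³`)

Sibling proof file of `LinearizedBoltzmannGaussWeightAction` and `LinearizedBoltzmannPointwiseInverse`.
For a solution `ψ` of Grad's integral equation `ν ψ = ∫∫ B (ψ' + ψ_*' - ψ_*) dω dM_* - g` (the pointwise
form of `L ψ = g`, `L` the linearised hard-sphere operator around the normalised Maxwellian `M` of `ℝ³`)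
dominated by a *truncated Gaussian weight* `|ψ| ≤ m W`, `W = max (e^{θ|·|²}, e^{|·|²/4}/N)`, we prove
the one-step improvement at large speed (`abs_le_half_weight_add_of_fixedPoint`):

`|ψ(y)| ≤ (m/2) W(y) + C₂ (‖ψ‖_{L²(M)} + ‖g‖_∞)`   whenever `s₀ |y|² ≥ 4 (K_θ + K_{1/4})`,

where `K_θ` are the Gaussian-weight gain constants of `exists_lintegral_gain_fst_gaussWeight_le`,
`ν(y) ≥ s₀ |y|`, and `C₂` only involves `σ(S²)`, `(∫ (1+|w|)² dM)^{1/2}` and the lower bounds of `ν`.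
Steps: the two gain pieces are `≤ m (K_θ + K_{1/4}) W(v)/|v|` each
(`lintegral_gain_fst_enorm_le_of_weight`, exchange symmetry `K₂'' = K₂'` of `ℝ³`), the loss piece is
`≤ σ(S²)(1 + |v|) m₂ ‖ψ‖_{L²(M)}` (Cauchy–Schwarz), whence `abs_kernelAction_le_of_weight`; dividing by
`ν(y) ≥ s₀|y|` absorbs the gain part into `(m/2) W`. This is the engine of the sub-Gaussian a-priori
estimate of `LinearizedBoltzmannSubGaussianInverse` (Grad 1963 / Guo 2010 weighted sup-norm scheme).
No new definitions are introduced.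
-/

open MeasureTheory Metric Real Set Filter Topology ProbabilityTheory Module
open scoped InnerProductSpace ENNReal

namespace Literature.Analysis.UnboundedOperators

noncomputable section

open Literature.MathematicalPhysics.KineticTheory (collide sphereMeasure hardSphereKernel
  lintegral_lintegral_hardSphere_gain_exchange)
open Literature.Analysis.FluidPDE

/-! ### The gain integral of a function dominated by a truncated Gaussian weight -/

/-- Measurability of the weighted gain integrand `(v_*, ω) ↦ ((v - v_*)·ω)₊ M(v_*) e^{θ|v'|²}`. [folklore] -/
theorem measurable_kernel_mul_globalMaxwellian_mul_exp_collide (θ : ℝ) (v : EuclideanSpace ℝ (Fin 3)) :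
    Measurable fun p : EuclideanSpace ℝ (Fin 3) × sphere (0 : EuclideanSpace ℝ (Fin 3)) 1 =>
      ENNReal.ofReal (hardSphereKernel (v, p.1) p.2 * globalMaxwellian p.1) *
        ENNReal.ofReal (Real.exp (θ * ‖(collide p.2 (v, p.1)).1‖ ^ 2)) := by
  have h1 : Continuous fun p : EuclideanSpace ℝ (Fin 3) × sphere (0 : EuclideanSpace ℝ (Fin 3)) 1 =>
      hardSphereKernel (v, p.1) p.2 * globalMaxwellian p.1 := by
    refine Continuous.mul ?_ (continuous_globalMaxwellian.comp continuous_fst)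
    unfold hardSphereKernel; fun_prop
  have h2 : Continuous fun p : EuclideanSpace ℝ (Fin 3) × sphere (0 : EuclideanSpace ℝ (Fin 3)) 1 =>
      Real.exp (θ * ‖(collide p.2 (v, p.1)).1‖ ^ 2) := by
    unfold collide; fun_prop
  exact h1.measurable.ennreal_ofReal.mul h2.measurable.ennreal_ofReal

/-- **The gain integral under a truncated Gaussian weight.** If `|ψ| ≤ m W` with
`W = max (e^{θ|·|²}, e^{|·|²/4}/N)` and the two Gaussian weights satisfy the gain bounds
`∫∫ B M e^{θ|v'|²} ≤ K e^{θ|v|²}/|v|`, `∫∫ B M e^{|v'|²/4} ≤ K' e^{|v|²/4}/|v|`, then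
`∫∫ ((v - v_*)·ω)₊ M(v_*) |ψ(v')| dω dv_* ≤ m (K + K') W(v) / |v|`. [folklore] -/
theorem lintegral_gain_fst_enorm_le_of_weight {ψ : EuclideanSpace ℝ (Fin 3) → ℝ} {θ N m K K' : ℝ}
    (hN : 0 < N) (hm : 0 ≤ m) (hK : 0 ≤ K) (hK' : 0 ≤ K')
    (hdom : ∀ y, |ψ y| ≤ m * max (Real.exp (θ * ‖y‖ ^ 2)) (Real.exp ((1 / 4 : ℝ) * ‖y‖ ^ 2) / N))
    {v : EuclideanSpace ℝ (Fin 3)} (hv : v ≠ 0)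
    (hKv : ∫⁻ w, ∫⁻ ω, ENNReal.ofReal (hardSphereKernel (v, w) ω * globalMaxwellian w) *
        ENNReal.ofReal (Real.exp (θ * ‖(collide ω (v, w)).1‖ ^ 2)) ∂sphereMeasure ≤
      ENNReal.ofReal (K * Real.exp (θ * ‖v‖ ^ 2) / ‖v‖))
    (hK'v : ∫⁻ w, ∫⁻ ω, ENNReal.ofReal (hardSphereKernel (v, w) ω * globalMaxwellian w) *
        ENNReal.ofReal (Real.exp ((1 / 4 : ℝ) * ‖(collide ω (v, w)).1‖ ^ 2)) ∂sphereMeasure ≤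
      ENNReal.ofReal (K' * Real.exp ((1 / 4 : ℝ) * ‖v‖ ^ 2) / ‖v‖)) :
    ∫⁻ w, ∫⁻ ω, ENNReal.ofReal (hardSphereKernel (v, w) ω * globalMaxwellian w) *
        ‖ψ (collide ω (v, w)).1‖ₑ ∂sphereMeasure ≤
      ENNReal.ofReal (m * (K + K') *
        max (Real.exp (θ * ‖v‖ ^ 2)) (Real.exp ((1 / 4 : ℝ) * ‖v‖ ^ 2) / N) / ‖v‖) := by
  have hvn : 0 < ‖v‖ := norm_pos_iff.2 hv
  set F₁ : EuclideanSpace ℝ (Fin 3) → sphere (0 : EuclideanSpace ℝ (Fin 3)) 1 → ℝ≥0∞ := fun w ω =>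
    ENNReal.ofReal (hardSphereKernel (v, w) ω * globalMaxwellian w) *
      ENNReal.ofReal (Real.exp (θ * ‖(collide ω (v, w)).1‖ ^ 2)) with hF₁
  set F₂ : EuclideanSpace ℝ (Fin 3) → sphere (0 : EuclideanSpace ℝ (Fin 3)) 1 → ℝ≥0∞ := fun w ω =>
    ENNReal.ofReal (hardSphereKernel (v, w) ω * globalMaxwellian w) *
      ENNReal.ofReal (Real.exp ((1 / 4 : ℝ) * ‖(collide ω (v, w)).1‖ ^ 2)) with hF₂
  have hF₁m : Measurable (Function.uncurry F₁) := measurable_kernel_mul_globalMaxwellian_mul_exp_collide θ v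
  have hF₂m : Measurable (Function.uncurry F₂) :=
    measurable_kernel_mul_globalMaxwellian_mul_exp_collide (1 / 4) v
  -- pointwise domination
  have hpt : ∀ w ω, ENNReal.ofReal (hardSphereKernel (v, w) ω * globalMaxwellian w) *
      ‖ψ (collide ω (v, w)).1‖ₑ ≤ ENNReal.ofReal m * (F₁ w ω + ENNReal.ofReal N⁻¹ * F₂ w ω) := by
    intro w ω
    set y := (collide ω (v, w)).1 with hy
    have hBM : 0 ≤ hardSphereKernel (v, w) ω * globalMaxwellian w :=
      mul_nonneg (le_max_right _ _) (globalMaxwellian_pos w).le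
    have hmax : max (Real.exp (θ * ‖y‖ ^ 2)) (Real.exp ((1 / 4 : ℝ) * ‖y‖ ^ 2) / N) ≤
        Real.exp (θ * ‖y‖ ^ 2) + N⁻¹ * Real.exp ((1 / 4 : ℝ) * ‖y‖ ^ 2) := by
      refine max_le (le_add_of_nonneg_right (by positivity)) ?_
      rw [div_eq_inv_mul]
      exact le_add_of_nonneg_left (Real.exp_nonneg _)
    have h1 : ‖ψ y‖ₑ ≤ ENNReal.ofReal (m * (Real.exp (θ * ‖y‖ ^ 2) + N⁻¹ * Real.exp ((1 / 4 : ℝ) * ‖y‖ ^ 2))) := by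
      rw [Real.enorm_eq_ofReal_abs]
      exact ENNReal.ofReal_le_ofReal ((hdom y).trans (mul_le_mul_of_nonneg_left hmax hm))
    calc ENNReal.ofReal (hardSphereKernel (v, w) ω * globalMaxwellian w) * ‖ψ y‖ₑ
        ≤ ENNReal.ofReal (hardSphereKernel (v, w) ω * globalMaxwellian w) *
            ENNReal.ofReal (m * (Real.exp (θ * ‖y‖ ^ 2) + N⁻¹ * Real.exp ((1 / 4 : ℝ) * ‖y‖ ^ 2))) :=
          mul_le_mul' le_rfl h1
      _ = ENNReal.ofReal m * (F₁ w ω + ENNReal.ofReal N⁻¹ * F₂ w ω) := by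
          rw [hF₁, hF₂]
          dsimp only
          rw [← hy, ENNReal.ofReal_mul hm, ENNReal.ofReal_add (Real.exp_nonneg _) (by positivity),
            ENNReal.ofReal_mul (inv_nonneg.2 hN.le)]
          ring
  -- integrate
  have hinner : ∀ w, ∫⁻ ω, ENNReal.ofReal m * (F₁ w ω + ENNReal.ofReal N⁻¹ * F₂ w ω) ∂sphereMeasure =
      ENNReal.ofReal m * ((∫⁻ ω, F₁ w ω ∂sphereMeasure) + ENNReal.ofReal N⁻¹ * ∫⁻ ω, F₂ w ω ∂sphereMeasure) := by
    intro w
    have hm1 : Measurable fun ω => F₁ w ω := hF₁m.of_uncurry_left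
    rw [lintegral_const_mul' _ _ ENNReal.ofReal_ne_top, lintegral_add_left hm1,
      lintegral_const_mul' _ _ ENNReal.ofReal_ne_top]
  have hout : ∫⁻ w, ENNReal.ofReal m * ((∫⁻ ω, F₁ w ω ∂sphereMeasure) +
      ENNReal.ofReal N⁻¹ * ∫⁻ ω, F₂ w ω ∂sphereMeasure) =
      ENNReal.ofReal m * ((∫⁻ w, ∫⁻ ω, F₁ w ω ∂sphereMeasure) +
        ENNReal.ofReal N⁻¹ * ∫⁻ w, ∫⁻ ω, F₂ w ω ∂sphereMeasure) := by
    have hm1 : Measurable fun w => ∫⁻ ω, F₁ w ω ∂(sphereMeasure : Measure (sphere (0 : EuclideanSpace ℝ (Fin 3)) 1)) :=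
      hF₁m.lintegral_prod_right'
    rw [lintegral_const_mul' _ _ ENNReal.ofReal_ne_top, lintegral_add_left hm1,
      lintegral_const_mul' _ _ ENNReal.ofReal_ne_top]
  calc ∫⁻ w, ∫⁻ ω, ENNReal.ofReal (hardSphereKernel (v, w) ω * globalMaxwellian w) *
          ‖ψ (collide ω (v, w)).1‖ₑ ∂sphereMeasure
      ≤ ∫⁻ w, ∫⁻ ω, ENNReal.ofReal m * (F₁ w ω + ENNReal.ofReal N⁻¹ * F₂ w ω) ∂sphereMeasure :=
        lintegral_mono fun w => lintegral_mono fun ω => hpt w ω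
    _ = ENNReal.ofReal m * ((∫⁻ w, ∫⁻ ω, F₁ w ω ∂sphereMeasure) +
          ENNReal.ofReal N⁻¹ * ∫⁻ w, ∫⁻ ω, F₂ w ω ∂sphereMeasure) := by
        rw [lintegral_congr hinner, hout]
    _ ≤ ENNReal.ofReal m * (ENNReal.ofReal (K * Real.exp (θ * ‖v‖ ^ 2) / ‖v‖) +
          ENNReal.ofReal N⁻¹ * ENNReal.ofReal (K' * Real.exp ((1 / 4 : ℝ) * ‖v‖ ^ 2) / ‖v‖)) :=
        mul_le_mul' le_rfl (add_le_add hKv (mul_le_mul' le_rfl hK'v))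
    _ = ENNReal.ofReal (m * (K * Real.exp (θ * ‖v‖ ^ 2) / ‖v‖ +
          N⁻¹ * (K' * Real.exp ((1 / 4 : ℝ) * ‖v‖ ^ 2) / ‖v‖))) := by
        rw [← ENNReal.ofReal_mul (inv_nonneg.2 hN.le), ← ENNReal.ofReal_add (by positivity) (by positivity),
          ← ENNReal.ofReal_mul hm]
    _ ≤ _ := by
        refine ENNReal.ofReal_le_ofReal ?_
        set Wv := max (Real.exp (θ * ‖v‖ ^ 2)) (Real.exp ((1 / 4 : ℝ) * ‖v‖ ^ 2) / N) with hWv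
        have h1 : Real.exp (θ * ‖v‖ ^ 2) ≤ Wv := le_max_left _ _
        have h2 : N⁻¹ * Real.exp ((1 / 4 : ℝ) * ‖v‖ ^ 2) ≤ Wv := by
          rw [inv_mul_eq_div]; exact le_max_right _ _
        rw [show m * (K * Real.exp (θ * ‖v‖ ^ 2) / ‖v‖ + N⁻¹ * (K' * Real.exp ((1 / 4 : ℝ) * ‖v‖ ^ 2) / ‖v‖)) =
          m * (K * Real.exp (θ * ‖v‖ ^ 2) + K' * (N⁻¹ * Real.exp ((1 / 4 : ℝ) * ‖v‖ ^ 2))) / ‖v‖ by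
          field_simp]
        rw [mul_assoc]
        refine div_le_div_of_nonneg_right (mul_le_mul_of_nonneg_left ?_ hm) hvn.le
        nlinarith [mul_le_mul_of_nonneg_left h1 hK, mul_le_mul_of_nonneg_left h2 hK']

/-- **The kernel action under a truncated Gaussian weight** (`ℝ³`): if `|ψ| ≤ m W`,
`W = max (e^{θ|·|²}, e^{|·|²/4}/N)`, and `ψ ∈ L²(M dv)` with `‖ψ‖ ≤ B`, then for `v ≠ 0`
`|∫∫ B (ψ' + ψ_*' - ψ_*)| ≤ 2 m (K + K') W(v)/|v| + σ(S²) (1 + |v|) m₂ B` — the two gain pieces by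
`lintegral_gain_fst_enorm_le_of_weight` and the exchange symmetry, the loss piece by Cauchy–Schwarz
(`m₂ = (∫ (1 + |w|)² dM)^{1/2}`). [folklore] -/
theorem abs_kernelAction_le_of_weight {ψ : EuclideanSpace ℝ (Fin 3) → ℝ} (hψm : Measurable ψ)
    (hψ2 : MemLp ψ 2 (stdGaussian (EuclideanSpace ℝ (Fin 3)))) {θ N m K K' B : ℝ}
    (hN : 0 < N) (hm : 0 ≤ m) (hK : 0 ≤ K) (hK' : 0 ≤ K')
    (hdom : ∀ y, |ψ y| ≤ m * max (Real.exp (θ * ‖y‖ ^ 2)) (Real.exp ((1 / 4 : ℝ) * ‖y‖ ^ 2) / N))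
    (hB : (eLpNorm ψ 2 (stdGaussian (EuclideanSpace ℝ (Fin 3)))).toReal ≤ B)
    {v : EuclideanSpace ℝ (Fin 3)} (hv : v ≠ 0)
    (hKv : ∫⁻ w, ∫⁻ ω, ENNReal.ofReal (hardSphereKernel (v, w) ω * globalMaxwellian w) *
        ENNReal.ofReal (Real.exp (θ * ‖(collide ω (v, w)).1‖ ^ 2)) ∂sphereMeasure ≤
      ENNReal.ofReal (K * Real.exp (θ * ‖v‖ ^ 2) / ‖v‖))
    (hK'v : ∫⁻ w, ∫⁻ ω, ENNReal.ofReal (hardSphereKernel (v, w) ω * globalMaxwellian w) *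
        ENNReal.ofReal (Real.exp ((1 / 4 : ℝ) * ‖(collide ω (v, w)).1‖ ^ 2)) ∂sphereMeasure ≤
      ENNReal.ofReal (K' * Real.exp ((1 / 4 : ℝ) * ‖v‖ ^ 2) / ‖v‖)) :
    |∫ w, ∫ ω, hardSphereKernel (v, w) ω * (ψ (collide ω (v, w)).1 + ψ (collide ω (v, w)).2 - ψ w)
        ∂sphereMeasure ∂stdGaussian (EuclideanSpace ℝ (Fin 3))| ≤
      2 * (m * (K + K') * max (Real.exp (θ * ‖v‖ ^ 2)) (Real.exp ((1 / 4 : ℝ) * ‖v‖ ^ 2) / N) / ‖v‖) +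
        (sphereMeasure : Measure (sphere (0 : EuclideanSpace ℝ (Fin 3)) 1)).real univ * (1 + ‖v‖) *
          (((∫⁻ w, ENNReal.ofReal ((1 + ‖w‖) ^ 2) ∂stdGaussian (EuclideanSpace ℝ (Fin 3))) ^ (1 / 2 : ℝ)).toReal * B) := by
  haveI := isFiniteMeasure_sphereMeasure (E := EuclideanSpace ℝ (Fin 3))
  set X : ℝ := m * (K + K') * max (Real.exp (θ * ‖v‖ ^ 2)) (Real.exp ((1 / 4 : ℝ) * ‖v‖ ^ 2) / N) / ‖v‖
    with hX
  have hX0 : 0 ≤ X := by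
    rw [hX]
    refine div_nonneg (mul_nonneg (mul_nonneg hm (add_nonneg hK hK')) ?_) (norm_nonneg _)
    exact le_max_of_le_left (Real.exp_nonneg _)
  set M2 : ℝ≥0∞ := (∫⁻ w, ENNReal.ofReal ((1 + ‖w‖) ^ 2) ∂stdGaussian (EuclideanSpace ℝ (Fin 3))) ^ (1 / 2 : ℝ)
    with hM2
  have hM2t : M2 ≠ ∞ := by
    refine ENNReal.rpow_ne_top_of_nonneg (by norm_num) ?_
    exact ((integrable_one_add_norm_pow_stdGaussian (E := EuclideanSpace ℝ (Fin 3)) 2).lintegral_lt_top).ne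
  set S : ℝ := (sphereMeasure : Measure (sphere (0 : EuclideanSpace ℝ (Fin 3)) 1)).real univ with hS
  have hS0 : 0 ≤ S := measureReal_nonneg
  set Nψ : ℝ≥0∞ := eLpNorm ψ 2 (stdGaussian (EuclideanSpace ℝ (Fin 3))) with hNψ
  have hNt : Nψ ≠ ∞ := hψ2.eLpNorm_ne_top
  have hc1 : Measurable fun p : EuclideanSpace ℝ (Fin 3) × sphere (0 : EuclideanSpace ℝ (Fin 3)) 1 =>
      (collide p.2 (v, p.1)).1 := by
    have : Continuous fun p : EuclideanSpace ℝ (Fin 3) × sphere (0 : EuclideanSpace ℝ (Fin 3)) 1 =>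
        (collide p.2 (v, p.1)).1 := by unfold collide; fun_prop
    exact this.measurable
  have hc2 : Measurable fun p : EuclideanSpace ℝ (Fin 3) × sphere (0 : EuclideanSpace ℝ (Fin 3)) 1 =>
      (collide p.2 (v, p.1)).2 := by
    have : Continuous fun p : EuclideanSpace ℝ (Fin 3) × sphere (0 : EuclideanSpace ℝ (Fin 3)) 1 =>
        (collide p.2 (v, p.1)).2 := by unfold collide; fun_prop
    exact this.measurable
  have I1 : ∫⁻ w, ∫⁻ ω, ENNReal.ofReal (hardSphereKernel (v, w) ω) * ‖ψ (collide ω (v, w)).1‖ₑ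
      ∂sphereMeasure ∂stdGaussian (EuclideanSpace ℝ (Fin 3)) ≤ ENNReal.ofReal X := by
    rw [lintegral_stdGaussian_kernel_eq_volume (U := fun p => ‖ψ (collide p.2 (v, p.1)).1‖ₑ)
      ((hψm.comp hc1).enorm) v]
    exact lintegral_gain_fst_enorm_le_of_weight hN hm hK hK' hdom hv hKv hK'v
  have I2 : ∫⁻ w, ∫⁻ ω, ENNReal.ofReal (hardSphereKernel (v, w) ω) * ‖ψ (collide ω (v, w)).2‖ₑ
      ∂sphereMeasure ∂stdGaussian (EuclideanSpace ℝ (Fin 3)) ≤ ENNReal.ofReal X := by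
    rw [lintegral_stdGaussian_kernel_eq_volume (U := fun p => ‖ψ (collide p.2 (v, p.1)).2‖ₑ)
      ((hψm.comp hc2).enorm) v,
      lintegral_lintegral_hardSphere_gain_exchange v globalMaxwellian volume hψm.enorm]
    exact lintegral_gain_fst_enorm_le_of_weight hN hm hK hK' hdom hv hKv hK'v
  have I3 : ∫⁻ w, ∫⁻ ω, ENNReal.ofReal (hardSphereKernel (v, w) ω) * ‖ψ w‖ₑ
      ∂sphereMeasure ∂stdGaussian (EuclideanSpace ℝ (Fin 3)) ≤ ENNReal.ofReal (S * (1 + ‖v‖)) * (M2 * Nψ) :=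
    lintegral_loss_enorm_le hψm v
  have htot := (enorm_kernelAction_le_add hψm v).trans (add_le_add (add_le_add I1 I2) I3)
  have hne3 : ENNReal.ofReal (S * (1 + ‖v‖)) * (M2 * Nψ) ≠ ∞ :=
    ENNReal.mul_ne_top ENNReal.ofReal_ne_top (ENNReal.mul_ne_top hM2t hNt)
  have hfin : ENNReal.ofReal X + ENNReal.ofReal X + ENNReal.ofReal (S * (1 + ‖v‖)) * (M2 * Nψ) ≠ ∞ :=
    ENNReal.add_ne_top.2 ⟨ENNReal.add_ne_top.2 ⟨ENNReal.ofReal_ne_top, ENNReal.ofReal_ne_top⟩, hne3⟩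
  have habs : |∫ w, ∫ ω, hardSphereKernel (v, w) ω *
        (ψ (collide ω (v, w)).1 + ψ (collide ω (v, w)).2 - ψ w) ∂sphereMeasure
          ∂stdGaussian (EuclideanSpace ℝ (Fin 3))| = (‖∫ w, ∫ ω, hardSphereKernel (v, w) ω *
        (ψ (collide ω (v, w)).1 + ψ (collide ω (v, w)).2 - ψ w) ∂sphereMeasure
          ∂stdGaussian (EuclideanSpace ℝ (Fin 3))‖ₑ).toReal := by
    rw [Real.enorm_eq_ofReal_abs, ENNReal.toReal_ofReal (abs_nonneg _)]
  rw [habs]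
  refine (ENNReal.toReal_mono hfin htot).trans ?_
  rw [ENNReal.toReal_add (ENNReal.add_ne_top.2 ⟨ENNReal.ofReal_ne_top, ENNReal.ofReal_ne_top⟩) hne3,
    ENNReal.toReal_add ENNReal.ofReal_ne_top ENNReal.ofReal_ne_top, ENNReal.toReal_ofReal hX0,
    ENNReal.toReal_mul, ENNReal.toReal_mul, ENNReal.toReal_ofReal (by positivity)]
  have h1 : M2.toReal * Nψ.toReal ≤ M2.toReal * B := mul_le_mul_of_nonneg_left hB ENNReal.toReal_nonneg
  have h2 := mul_le_mul_of_nonneg_left h1 (by positivity : 0 ≤ S * (1 + ‖v‖))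
  linarith


/-! ### The a-priori estimate: from Gaussian growth `e^{|v|²/4}` down to `e^{θ|v|²}`, any `θ > 0` -/

/-- **Off-ball absorption step.** Under the integral equation `ν ψ = ∫∫ B (ψ' + ψ_*' - ψ_*) - g` at a
velocity `y` with `s₀ |y|² ≥ 4 (K + K')`, the domination `|ψ| ≤ m W` (`W` the truncated Gaussian weight)
improves at `y` to `|ψ(y)| ≤ (m/2) W(y) + C₂ (B + b)`, `C₂ = σ(S²) m₂ (ν₀⁻¹ + s₀⁻¹) + ν₀⁻¹`
(`ν(y) ≥ s₀ |y|`, `ν(y) ≥ ν₀`, `‖ψ‖_{L²(M)} ≤ B`, `|g| ≤ b`). [folklore] -/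
theorem abs_le_half_weight_add_of_fixedPoint {ψ g : EuclideanSpace ℝ (Fin 3) → ℝ} (hψm : Measurable ψ)
    (hψ2 : MemLp ψ 2 (stdGaussian (EuclideanSpace ℝ (Fin 3)))) {θ N m K K' B b s₀ ν₀ : ℝ}
    (hN : 0 < N) (hm : 0 ≤ m) (hK : 0 ≤ K) (hK' : 0 ≤ K') (hB0 : 0 ≤ B) (hb0 : 0 ≤ b) (hs₀ : 0 < s₀) (hν₀ : 0 < ν₀)
    (hdom : ∀ y, |ψ y| ≤ m * max (Real.exp (θ * ‖y‖ ^ 2)) (Real.exp ((1 / 4 : ℝ) * ‖y‖ ^ 2) / N))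
    (hB : (eLpNorm ψ 2 (stdGaussian (EuclideanSpace ℝ (Fin 3)))).toReal ≤ B)
    {y : EuclideanSpace ℝ (Fin 3)} (hy0 : y ≠ 0) (hy : 4 * (K + K') ≤ s₀ * ‖y‖ ^ 2)
    (hνs : s₀ * ‖y‖ ≤ collisionFrequency y) (hνy : ν₀ ≤ collisionFrequency y) (hgb : |g y| ≤ b)
    (hKv : ∫⁻ w, ∫⁻ ω, ENNReal.ofReal (hardSphereKernel (y, w) ω * globalMaxwellian w) *
        ENNReal.ofReal (Real.exp (θ * ‖(collide ω (y, w)).1‖ ^ 2)) ∂sphereMeasure ≤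
      ENNReal.ofReal (K * Real.exp (θ * ‖y‖ ^ 2) / ‖y‖))
    (hK'v : ∫⁻ w, ∫⁻ ω, ENNReal.ofReal (hardSphereKernel (y, w) ω * globalMaxwellian w) *
        ENNReal.ofReal (Real.exp ((1 / 4 : ℝ) * ‖(collide ω (y, w)).1‖ ^ 2)) ∂sphereMeasure ≤
      ENNReal.ofReal (K' * Real.exp ((1 / 4 : ℝ) * ‖y‖ ^ 2) / ‖y‖))
    (hfix : collisionFrequency y * ψ y =
      (∫ w, ∫ ω, hardSphereKernel (y, w) ω * (ψ (collide ω (y, w)).1 + ψ (collide ω (y, w)).2 - ψ w)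
        ∂sphereMeasure ∂stdGaussian (EuclideanSpace ℝ (Fin 3))) - g y) :
    |ψ y| ≤ m / 2 * max (Real.exp (θ * ‖y‖ ^ 2)) (Real.exp ((1 / 4 : ℝ) * ‖y‖ ^ 2) / N) +
      ((sphereMeasure : Measure (sphere (0 : EuclideanSpace ℝ (Fin 3)) 1)).real univ *
        (((∫⁻ w, ENNReal.ofReal ((1 + ‖w‖) ^ 2) ∂stdGaussian (EuclideanSpace ℝ (Fin 3))) ^ (1 / 2 : ℝ)).toReal) *
          (1 / ν₀ + 1 / s₀) + 1 / ν₀) * (B + b) := by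
  set S : ℝ := (sphereMeasure : Measure (sphere (0 : EuclideanSpace ℝ (Fin 3)) 1)).real univ with hS
  have hS0 : 0 ≤ S := measureReal_nonneg
  set m₂ : ℝ := (((∫⁻ w, ENNReal.ofReal ((1 + ‖w‖) ^ 2) ∂stdGaussian (EuclideanSpace ℝ (Fin 3))) ^
    (1 / 2 : ℝ))).toReal with hm₂
  have hm₂0 : 0 ≤ m₂ := ENNReal.toReal_nonneg
  set W : ℝ := max (Real.exp (θ * ‖y‖ ^ 2)) (Real.exp ((1 / 4 : ℝ) * ‖y‖ ^ 2) / N) with hW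
  have hWpos : 0 < W := lt_max_of_lt_left (Real.exp_pos _)
  have hyn : 0 < ‖y‖ := norm_pos_iff.2 hy0
  have hν : 0 < collisionFrequency y := hν₀.trans_le hνy
  have hKψ := abs_kernelAction_le_of_weight hψm hψ2 hN hm hK hK' hdom hB hy0 hKv hK'v
  rw [← hS, ← hm₂, ← hW] at hKψ
  set Kψ := ∫ w, ∫ ω, hardSphereKernel (y, w) ω * (ψ (collide ω (y, w)).1 + ψ (collide ω (y, w)).2 - ψ w)
    ∂sphereMeasure ∂stdGaussian (EuclideanSpace ℝ (Fin 3)) with hKψdef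
  -- `|ψ y| ν ≤ |Kψ| + b`
  have hψy : |ψ y| * collisionFrequency y ≤ |Kψ| + b := by
    have : ψ y * collisionFrequency y = Kψ - g y := by rw [mul_comm]; exact hfix
    rw [← abs_of_pos hν, ← abs_mul, this]
    exact (abs_sub _ _).trans (add_le_add le_rfl hgb)
  -- gain part: `2 m (K + K') W / |y| ≤ (m/2) W ν`
  have hgain : 2 * (m * (K + K') * W / ‖y‖) ≤ m / 2 * W * collisionFrequency y := by
    have hmW : 0 ≤ m * W := mul_nonneg hm hWpos.le
    calc 2 * (m * (K + K') * W / ‖y‖) = (m * W) * (2 * (K + K')) / ‖y‖ := by ring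
      _ ≤ (m * W) * (s₀ * ‖y‖ ^ 2 / 2) / ‖y‖ :=
          div_le_div_of_nonneg_right (mul_le_mul_of_nonneg_left (by linarith) hmW) hyn.le
      _ = m / 2 * W * (s₀ * ‖y‖) := by field_simp
      _ ≤ m / 2 * W * collisionFrequency y := mul_le_mul_of_nonneg_left hνs (by positivity)
  -- loss and source parts: `S (1 + |y|) m₂ B + b ≤ C₂ (B + b) ν`
  have h1 : 1 ≤ collisionFrequency y / ν₀ := by rw [le_div_iff₀ hν₀, one_mul]; exact hνy
  have h2 : ‖y‖ ≤ collisionFrequency y / s₀ := by rw [le_div_iff₀ hs₀, mul_comm]; exact hνs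
  have hrest : S * (1 + ‖y‖) * (m₂ * B) + b ≤ (S * m₂ * (1 / ν₀ + 1 / s₀) + 1 / ν₀) * (B + b) * collisionFrequency y := by
    have hSmB : 0 ≤ S * m₂ * B := by positivity
    have i1 : S * (1 + ‖y‖) * (m₂ * B) ≤ S * m₂ * B * (collisionFrequency y / ν₀ + collisionFrequency y / s₀) := by
      rw [show S * (1 + ‖y‖) * (m₂ * B) = S * m₂ * B * (1 + ‖y‖) by ring]
      exact mul_le_mul_of_nonneg_left (add_le_add h1 h2) hSmB
    have i2 : b ≤ b * (collisionFrequency y / ν₀) := le_mul_of_one_le_right hb0 h1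
    have i3 : 0 ≤ S * m₂ * b * (collisionFrequency y / ν₀ + collisionFrequency y / s₀) := by positivity
    have i4 : 0 ≤ B * (collisionFrequency y / ν₀) := by positivity
    have e : (S * m₂ * (1 / ν₀ + 1 / s₀) + 1 / ν₀) * (B + b) * collisionFrequency y =
        S * m₂ * B * (collisionFrequency y / ν₀ + collisionFrequency y / s₀) +
          S * m₂ * b * (collisionFrequency y / ν₀ + collisionFrequency y / s₀) +
          B * (collisionFrequency y / ν₀) + b * (collisionFrequency y / ν₀) := by
      field_simp
      ring
    rw [e]
    linarith
  -- combine and divide by `ν`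
  have htot : |ψ y| * collisionFrequency y ≤
      (m / 2 * W + (S * m₂ * (1 / ν₀ + 1 / s₀) + 1 / ν₀) * (B + b)) * collisionFrequency y := by
    rw [add_mul]
    linarith
  exact le_of_mul_le_mul_right htot hν


end

end Literature.Analysis.UnboundedOperators
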